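import Summits.Ventures.HodgeRepro2.T5SU11ResolventTransform
import Summits.Ventures.HodgeRepro2.T5SU11SphericalDecayBracket

/-!
# The energy bracket of the resolvent: `(sinh 2t · u u′)′ = sinh 2t (u′)² + μ sinh 2t u² + sinh 2t f u`, its
boundary terms, and the integrability of `sinh 2t (G_λ f)²`

For `u` solving the inhomogeneous radial equation `sinh 2t · u″ + 2 cosh 2t · u′ = μ sinh 2t · u + sinh 2t · f` on
`(0, ∞)`, the **energy bracket** `E = sinh 2t · u u′` has the derivative

  **`E′ = sinh 2t (u′)² + μ sinh 2t u² + sinh 2t f u`**  (`hasDerivAt_energy_bracket`),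

so that on `[ε, R] ⊂ (0, ∞)` **`∫_ε^R (sinh 2t (u′)² + μ sinh 2t u² + sinh 2t f u) = E(R) − E(ε)`**
(`energy_identity_inhom`). For `u = G_λ f` (`λ > 1`, `f` continuous and supported in `[a, b]`):
**`E(ε) → 0`** as `ε → 0⁺` (`tendsto_energy_bracket_left`: `E = c₁² sinh 2ε φ_λ φ_λ′` on `(0, a]`, continuous
at `0` with value `0`), **`E(R) → 0`** as `R → ∞` (`tendsto_energy_bracket_right`: `E = c₂² sinh 2R χ_λ χ_λ′` on
`[b, ∞)`, row 473), and **`sinh 2t (G_λ f)²` is integrable on `(0, ∞)`** (`integrableOn_sinh_mul_sphGreen_sq`)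
while `sinh 2t (G_λ f)′²` and `sinh 2t (G_λ f)²` are integrable on every `(0, R]`
(`integrableOn_sinh_mul_sphGreen'_sq_Ioc`, `integrableOn_sinh_mul_sphGreen_sq_Ioc`). Also a general device for
the passage `ε → 0⁺`: `∫_0^ε u → 0` when `u` agrees on `(0, a]` with a continuous function
(`tendsto_integral_nhdsGT_zero_of_eqOn`). The identity itself is assembled in the next row. Nothing is claimed
about (N).

Blind lane: Mathlib + the HodgeRepro2 prefix only; no sorry; axioms ⊆ {propext, Classical.choice,
Quot.sound}.
-/

namespace Summit.Ventures.HodgeRepro2.T5SU11ResolventEnergyPieces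

open Filter Topology MeasureTheory intervalIntegral
open Set (Ioi Ioc Icc uIcc)
open T5SU11Cartan T5SU11SphericalFunction T5SU11SphericalBounds T5SU11SphericalContinuous
  T5SU11SphericalAsymptotic T5SU11SphericalCfun T5SU11ReductionOfOrder T5SU11ReductionOfOrderInfinity
  T5SU11SphericalSolutionSpaceAll T5SU11SphericalDecay T5SU11SphericalDecayAsymptotic T5SU11RadialGreen
  T5SU11SphericalGreen T5SU11ResolventBoundary T5SU11ResolventTransform T5SU11SphericalDecayBracket
  T5SU11SphericalLegendreHigher

/-! ### The energy bracket of the inhomogeneous equation -/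

section

variable {μ : ℝ} {u u' u'' f : ℝ → ℝ}
  (hu : ∀ t, 0 < t → HasDerivAt u (u' t) t) (hu' : ∀ t, 0 < t → HasDerivAt u' (u'' t) t)
  (huode : ∀ t, 0 < t → Real.sinh (2 * t) * u'' t + 2 * Real.cosh (2 * t) * u' t
    = μ * Real.sinh (2 * t) * u t + Real.sinh (2 * t) * f t)
  (hf : ContinuousOn f (Ioi 0))

include hu hu' huode in
/-- **`E′ = sinh 2t (u′)² + μ sinh 2t u² + sinh 2t f u`** for the energy bracket `E = sinh 2t · u u′`. -/
theorem hasDerivAt_energy_bracket {t : ℝ} (ht : 0 < t) :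
    HasDerivAt (fun t => Real.sinh (2 * t) * (u t * u' t))
      (Real.sinh (2 * t) * u' t ^ 2 + μ * (Real.sinh (2 * t) * u t ^ 2) + Real.sinh (2 * t) * (f t * u t)) t := by
  have h := (hasDerivAt_sinh_two_mul_self t).mul ((hu t ht).mul (hu' t ht))
  refine h.congr_deriv ?_
  simp only [Pi.mul_apply]
  have e := huode t ht
  linear_combination (u t) * e

include hu hu' huode hf in
/-- **The energy identity on `[ε, R] ⊂ (0, ∞)`**:
`∫_ε^R (sinh 2t (u′)² + μ sinh 2t u² + sinh 2t f u) = E(R) − E(ε)`. -/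
theorem energy_identity_inhom {ε R : ℝ} (hε : 0 < ε) (hεR : ε ≤ R) :
    ∫ t in ε..R, (Real.sinh (2 * t) * u' t ^ 2 + μ * (Real.sinh (2 * t) * u t ^ 2)
        + Real.sinh (2 * t) * (f t * u t))
      = Real.sinh (2 * R) * (u R * u' R) - Real.sinh (2 * ε) * (u ε * u' ε) := by
  have hR : 0 < R := lt_of_lt_of_le hε hεR
  have hsub : uIcc ε R ⊆ Ioi 0 := uIcc_subset_Ioi hε hR
  have hcu : ContinuousOn u (Ioi 0) := fun t ht => (hu t ht).continuousAt.continuousWithinAt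
  have hcu' : ContinuousOn u' (Ioi 0) := fun t ht => (hu' t ht).continuousAt.continuousWithinAt
  have hcs : ContinuousOn (fun t => Real.sinh (2 * t)) (Ioi 0) :=
    (Real.continuous_sinh.comp (continuous_const.mul continuous_id)).continuousOn
  have hint : IntervalIntegrable (fun t => Real.sinh (2 * t) * u' t ^ 2 + μ * (Real.sinh (2 * t) * u t ^ 2)
      + Real.sinh (2 * t) * (f t * u t)) volume ε R :=
    ((((hcs.mul (hcu'.pow 2)).add ((hcs.mul (hcu.pow 2)).const_smul μ)).add
      (hcs.mul (hf.mul hcu))).mono hsub).intervalIntegrable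
  exact integral_eq_sub_of_hasDerivAt (fun t ht => hasDerivAt_energy_bracket hu hu' huode (hsub ht)) hint

end

/-! ### A device for the passage `ε → 0⁺` -/

/-- If `u` agrees on `(0, a]` with a continuous function `g`, then `∫_0^ε u → 0` as `ε → 0⁺`. -/
theorem tendsto_integral_nhdsGT_zero_of_eqOn {u g : ℝ → ℝ} (hg : Continuous g) {a : ℝ} (ha : 0 < a)
    (heq : ∀ t, 0 < t → t ≤ a → u t = g t) :
    Tendsto (fun ε => ∫ t in (0 : ℝ)..ε, u t) (𝓝[>] 0) (𝓝 0) := by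
  have hprim : Tendsto (fun ε => ∫ t in (0 : ℝ)..ε, g t) (𝓝 0) (𝓝 (∫ t in (0 : ℝ)..(0 : ℝ), g t)) := by
    have hd := integral_hasDerivAt_right (hg.intervalIntegrable 0 0) (hg.stronglyMeasurableAtFilter _ _)
      hg.continuousAt
    exact hd.continuousAt.tendsto
  rw [integral_same] at hprim
  refine (hprim.mono_left (nhdsWithin_le_nhds (s := Ioi 0))).congr' ?_
  filter_upwards [Ioo_mem_nhdsGT ha] with ε hε
  refine integral_congr_ae (Filter.Eventually.of_forall fun t ht => ?_)
  rw [Set.uIoc_of_le hε.1.le] at ht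
  exact (heq t ht.1 (le_trans ht.2 hε.2.le)).symm

section measure

variable [MeasurableSpace Circle] [BorelSpace Circle]

variable {lam a b : ℝ} {f : ℝ → ℝ} (hlam : 1 < lam) (hf : ContinuousOn f (Ioi 0))
  (ha : 0 < a) (hab : a ≤ b) (hfa : ∀ s, s ≤ a → f s = 0) (hfb : ∀ s, b ≤ s → f s = 0)

/-! ### The boundary terms for `u = G_λ f` -/

include hlam hf ha hab hfa in
/-- **`E(ε) → 0` as `ε → 0⁺`**: on `(0, a]`, `E = c₁² sinh 2ε φ_λ(a_ε) φ_λ′(ε)`. -/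
theorem tendsto_energy_bracket_left :
    Tendsto (fun ε => Real.sinh (2 * ε) * (sphGreen lam f a b ε * sphGreen' lam f a b ε)) (𝓝[>] 0) (𝓝 0) := by
  set c₁ := ∫ s in a..b, sphDecay lam s * f s * Real.sinh (2 * s) with hc₁
  have hcont : Continuous fun ε => Real.sinh (2 * ε) * (c₁ * sph lam (hyp ε) * (c₁ * deriv (fun t => sph lam (hyp t)) ε)) := by
    have h1 : Continuous (deriv fun t => sph lam (hyp t)) :=
      continuous_iff_continuousAt.mpr fun t => (hasDerivAt_deriv_sph_hyp lam t).continuousAt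
    exact (Real.continuous_sinh.comp (continuous_const.mul continuous_id)).mul
      ((continuous_const.mul (continuous_sph_hyp lam)).mul (continuous_const.mul h1))
  have h0 := hcont.tendsto 0
  simp only [mul_zero, Real.sinh_zero, zero_mul] at h0
  refine (h0.mono_left (nhdsWithin_le_nhds (s := Ioi 0))).congr' ?_
  filter_upwards [Ioo_mem_nhdsGT ha] with ε hε
  obtain ⟨hu, hu'⟩ := sphGreen_of_le (lam := lam) (lam' := (1 + lam) / 2) (by linarith) (by linarith) hf ha hab hfa hε.1 hε.2.le
  rw [hu, hu']
  ring

include hlam hf ha hab hfb in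
/-- **`E(R) → 0` as `R → ∞`**: on `[b, ∞)`, `E = c₂² sinh 2R χ_λ χ_λ′` (row 473). -/
theorem tendsto_energy_bracket_right :
    Tendsto (fun R => Real.sinh (2 * R) * (sphGreen lam f a b R * sphGreen' lam f a b R)) atTop (𝓝 0) := by
  set c₂ := ∫ s in a..b, sph lam (hyp s) * f s * Real.sinh (2 * s) with hc₂
  have h := (tendsto_sinh_mul_sphDecay_mul_sphDecay' hlam).const_mul (c₂ ^ 2)
  rw [mul_zero] at h
  refine h.congr' ?_
  filter_upwards [eventually_ge_atTop b] with R hR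
  obtain ⟨hu, hu'⟩ := sphGreen_of_ge hf ha hab hfb hR
  rw [hu, hu']
  ring

/-! ### Integrability -/

include hlam hf ha hab in
/-- `sinh 2t (G_λ f)′²` is continuous on `(0, ∞)`. -/
theorem continuousOn_sinh_mul_sphGreen'_sq :
    ContinuousOn (fun t => Real.sinh (2 * t) * sphGreen' lam f a b t ^ 2) (Ioi 0) := by
  have hu : ContinuousOn (sphGreen' lam f a b) (Ioi 0) :=
    fun t ht => (hasDerivAt_sphGreen' hlam hf ha hab ht).continuousAt.continuousWithinAt
  exact (Real.continuous_sinh.comp (continuous_const.mul continuous_id)).continuousOn.mul (hu.pow 2)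

include hlam hf ha hab in
/-- `sinh 2t (G_λ f)²` is continuous on `(0, ∞)`. -/
theorem continuousOn_sinh_mul_sphGreen_sq :
    ContinuousOn (fun t => Real.sinh (2 * t) * sphGreen lam f a b t ^ 2) (Ioi 0) := by
  have hu : ContinuousOn (sphGreen lam f a b) (Ioi 0) :=
    fun t ht => (hasDerivAt_sphGreen hlam hf ha hab ht).continuousAt.continuousWithinAt
  exact (Real.continuous_sinh.comp (continuous_const.mul continuous_id)).continuousOn.mul (hu.pow 2)

include hlam hf ha hab hfa in
/-- **`sinh 2t (G_λ f)′²` is integrable on every `(0, R]`.** -/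
theorem integrableOn_sinh_mul_sphGreen'_sq_Ioc (R : ℝ) :
    IntegrableOn (fun t => Real.sinh (2 * t) * sphGreen' lam f a b t ^ 2) (Ioc 0 R) := by
  set c₁ := ∫ s in a..b, sphDecay lam s * f s * Real.sinh (2 * s) with hc₁
  have h1 : Continuous (deriv fun t => sph lam (hyp t)) :=
    continuous_iff_continuousAt.mpr fun t => (hasDerivAt_deriv_sph_hyp lam t).continuousAt
  have hg : Continuous fun t => Real.sinh (2 * t) * (-c₁ * deriv (fun t => sph lam (hyp t)) t) ^ 2 :=
    (Real.continuous_sinh.comp (continuous_const.mul continuous_id)).mul ((continuous_const.mul h1).pow 2)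
  have hI1 : IntegrableOn (fun t => Real.sinh (2 * t) * sphGreen' lam f a b t ^ 2) (Ioc 0 a) := by
    refine (hg.integrableOn_Icc.mono_set Set.Ioc_subset_Icc_self).congr_fun (fun t ht => ?_) measurableSet_Ioc
    rw [(sphGreen_of_le (lam := lam) (lam' := (1 + lam) / 2) (by linarith) (by linarith) hf ha hab hfa ht.1 ht.2).2]
  have hI2 : IntegrableOn (fun t => Real.sinh (2 * t) * sphGreen' lam f a b t ^ 2) (Ioc a R) :=
    (((continuousOn_sinh_mul_sphGreen'_sq hlam hf ha hab).mono
      (fun t ht => lt_of_lt_of_le ha ht.1)).integrableOn_Icc).mono_set Set.Ioc_subset_Icc_self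
  rcases le_or_gt a R with haR | haR
  · have := hI1.union hI2
    rwa [Set.Ioc_union_Ioc_eq_Ioc ha.le haR] at this
  · exact hI1.mono_set (Set.Ioc_subset_Ioc_right haR.le)

include hlam hf ha hab hfa in
/-- **`sinh 2t (G_λ f)²` is integrable on every `(0, R]`.** -/
theorem integrableOn_sinh_mul_sphGreen_sq_Ioc (R : ℝ) :
    IntegrableOn (fun t => Real.sinh (2 * t) * sphGreen lam f a b t ^ 2) (Ioc 0 R) := by
  set c₁ := ∫ s in a..b, sphDecay lam s * f s * Real.sinh (2 * s) with hc₁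
  have hg : Continuous fun t => Real.sinh (2 * t) * (-c₁ * sph lam (hyp t)) ^ 2 :=
    (Real.continuous_sinh.comp (continuous_const.mul continuous_id)).mul
      ((continuous_const.mul (continuous_sph_hyp lam)).pow 2)
  have hI1 : IntegrableOn (fun t => Real.sinh (2 * t) * sphGreen lam f a b t ^ 2) (Ioc 0 a) := by
    refine (hg.integrableOn_Icc.mono_set Set.Ioc_subset_Icc_self).congr_fun (fun t ht => ?_) measurableSet_Ioc
    rw [(sphGreen_of_le (lam := lam) (lam' := (1 + lam) / 2) (by linarith) (by linarith) hf ha hab hfa ht.1 ht.2).1]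
  have hI2 : IntegrableOn (fun t => Real.sinh (2 * t) * sphGreen lam f a b t ^ 2) (Ioc a R) :=
    (((continuousOn_sinh_mul_sphGreen_sq hlam hf ha hab).mono
      (fun t ht => lt_of_lt_of_le ha ht.1)).integrableOn_Icc).mono_set Set.Ioc_subset_Icc_self
  rcases le_or_gt a R with haR | haR
  · have := hI1.union hI2
    rwa [Set.Ioc_union_Ioc_eq_Ioc ha.le haR] at this
  · exact hI1.mono_set (Set.Ioc_subset_Ioc_right haR.le)

include hlam hf ha hab hfa hfb in
/-- **`sinh 2t (G_λ f)²` is integrable on `(0, ∞)`**: `O(e^{−(2λ−2)t})` at infinity. -/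
theorem integrableOn_sinh_mul_sphGreen_sq :
    IntegrableOn (fun t => Real.sinh (2 * t) * sphGreen lam f a b t ^ 2) (Ioi 0) := by
  have hb : 0 < b := lt_of_lt_of_le ha hab
  set c₂ := ∫ s in a..b, sph lam (hyp s) * f s * Real.sinh (2 * s) with hc₂
  set L := 1 / ((lam - 1) * cfun (2 - lam)) with hL
  have hLpos : 0 < L := sphDecay_limit_pos hlam
  obtain ⟨T₀, hT₀⟩ := eventually_atTop.mp (eventually_sphDecay_le hlam)
  set T := max T₀ b with hT
  have hbT : b ≤ T := le_max_right _ _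
  have hcont := continuousOn_sinh_mul_sphGreen_sq hlam hf ha hab
  have hI1 := integrableOn_sinh_mul_sphGreen_sq_Ioc hlam hf ha hab hfa T
  have hI2 : IntegrableOn (fun t => Real.sinh (2 * t) * sphGreen lam f a b t ^ 2) (Ioi T) := by
    set C := c₂ ^ 2 * (2 * L) ^ 2 / 2 with hC
    have hmaj : IntegrableOn (fun t => C * Real.exp (-(2 * lam - 2) * t)) (Ioi T) :=
      (exp_neg_integrableOn_Ioi T (by linarith)).const_mul _
    refine hmaj.mono' ?_ ?_
    · exact (hcont.mono (Set.Ioi_subset_Ioi (le_trans hb.le hbT))).aestronglyMeasurable measurableSet_Ioi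
    · refine ae_restrict_of_forall_mem measurableSet_Ioi (fun t ht => ?_)
      have ht' : T < t := ht
      have htb : b ≤ t := le_trans hbT ht'.le
      have ht0 : 0 < t := lt_of_lt_of_le hb htb
      have hb1 := hT₀ t (le_trans (le_max_left _ _) ht'.le)
      rw [(sphGreen_of_ge hf ha hab hfb htb).1, Real.norm_eq_abs]
      have hs : Real.sinh (2 * t) ≤ Real.exp (2 * t) / 2 := sinh_le_exp_div_two _
      have hs0 : 0 ≤ Real.sinh (2 * t) := Real.sinh_nonneg_iff.mpr (by linarith)
      have hχ0 : 0 ≤ sphDecay lam t := (sphDecay_pos hlam ht0).le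
      have hsq : (-c₂ * sphDecay lam t) ^ 2 ≤ c₂ ^ 2 * (2 * L * Real.exp (-lam * t)) ^ 2 := by
        rw [mul_pow, neg_sq]
        exact mul_le_mul_of_nonneg_left (pow_le_pow_left₀ hχ0 hb1 2) (sq_nonneg _)
      rw [abs_of_nonneg (mul_nonneg hs0 (sq_nonneg _))]
      calc Real.sinh (2 * t) * (-c₂ * sphDecay lam t) ^ 2
          ≤ (Real.exp (2 * t) / 2) * (c₂ ^ 2 * (2 * L * Real.exp (-lam * t)) ^ 2) :=
            mul_le_mul hs hsq (sq_nonneg _) (by positivity)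
        _ = C * Real.exp (-(2 * lam - 2) * t) := by
            rw [hC, show Real.exp (-(2 * lam - 2) * t) = Real.exp (2 * t) * Real.exp (-lam * t) ^ 2 by
              rw [← Real.exp_nat_mul, ← Real.exp_add]; congr 1; push_cast; ring]
            ring
  have := hI1.union hI2
  rwa [Set.Ioc_union_Ioi_eq_Ioi (le_trans hb.le hbT)] at this

end measure

end Summit.Ventures.HodgeRepro2.T5SU11ResolventEnergyPieces
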